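import Literature.AlgebraicGeometry.Frobenioids.EquivalenceFrobeniusType
import HarnessLib

/-!
# Frobenioids I, §3: Theorem 3.4 (iii) from Theorem 3.4 (ii) — prime-Frobenius morphisms and
# morphisms of Frobenius type (isotropic type; pre-step preservation as a HYPOTHESIS)

Mochizuki, *The geometry of Frobenioids I: the general theory*, Kyushu J. Math. **62** (2008),
Thm. 3.4 (iii), proof, claims (F1), (F2) and "since `C₁` is connected", kurims pp. 64–65: "Since [by
assertion (ii)] `Ψ` preserves pre-steps, it thus follows formally from … Proposition 1.14, (v), that `Ψ`
maps `φ₁` to a prime-Frobenius endomorphism" [cite: MochizukiFrdI2008, Thm. 3.4 (iii) p.65].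

PROOF-ONLY file (seat abc-iut-L1-t11; GAP-LEDGER row G-L1d8-1, printed generality of Thm. 3.4
(iii)–(v)). Seat abc-iut-L1-t13's `EquivalenceFrobeniusEndomorphisms.lean` / `EquivalenceFrobeniusType.lean`
prove these statements over bases of FSM-type, the FSM hypothesis entering ONLY through "`Ψ`, `Ψ⁻¹`
preserve pre-steps" (`FrdI.isPreStep_map_of_isOfFSMType`). Here the same proofs are run with exactly
that — the CONCLUSION of Thm. 3.4 (ii) for `Ψ` and `Ψ⁻¹` — as hypotheses `hΨ`, `hΨ'`, so that ANY proof
of (ii) (FSM-type bases, abc-iut-L1-t13; FSMFF-type bases in the author's revised sense,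
`FrdI.isPreStep_map_of_isOfFSMFFType2024`; …) yields (iii) "formally", as print says: for Frobenioids
`C₁`, `C₂` of isotropic type, `Φ₂` non-dilating, `C₁` with a non-group-like object, `Ψ` maps
prime-Frobenius morphisms to prime-Frobenius morphisms (`FrdI.OfPreSteps.isPrimeFrobenius_map`; (F1) via
Prop. 1.14 (v), (F2), Def. 1.3 (i)(a)(b)(c), connectedness of `D₁`) and preserves morphisms of Frobenius
type (`FrdI.OfPreSteps.isFrobeniusType_map`, Prop. 1.10 (v)). No statement of the paper is restated.
-/

set_option backward.isDefEq.respectTransparency false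

namespace Literature.AlgebraicGeometry.Frobenioids

open CategoryTheory Opposite

universe w v v' u u'

namespace FrdI

namespace OfPreSteps

section Two

variable {D₁ : Type u} [Category.{v} D₁] {Φ₁ : D₁ᵒᵖ ⥤ CommMonCat.{w}} {C₁ : Type u'}
  [Category.{v'} C₁] {D₂ : Type u} [Category.{v} D₂] {Φ₂ : D₂ᵒᵖ ⥤ CommMonCat.{w}} {C₂ : Type u'}
  [Category.{v'} C₂] {F₁ : C₁ ⥤ ElemFrobenioid Φ₁} {F₂ : C₂ ⥤ ElemFrobenioid Φ₂}

/-! ### Pre-step preservation in both directions: first consequences -/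

/-- If `Ψ⁻¹` preserves pre-steps, `Ψ` preserves group-like objects (isotropic type: an object is
group-like iff every pre-step out of it is invertible, Def. 1.3 (iii)(d)).
[cite: MochizukiFrdI2008, Thm. 3.4 (ii) p.62] -/
theorem isGroupLikeObj_map (hF₁ : PreFrobenioid.IsFrobenioid F₁)
    (hF₂ : PreFrobenioid.IsFrobenioid F₂) (hi₁ : ∀ A : C₁, PreFrobenioid.IsIsotropic F₁ A)
    (hi₂ : ∀ A : C₂, PreFrobenioid.IsIsotropic F₂ A) (Ψ : C₁ ≌ C₂)
    (hΨ' : ∀ ⦃A B : C₂⦄ ⦃φ : A ⟶ B⦄, PreFrobenioid.IsPreStep F₂ φ →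
      PreFrobenioid.IsPreStep F₁ (Ψ.inverse.map φ))
    {A : C₁} (hA : PreFrobenioid.IsGroupLikeObj F₁ A) :
    PreFrobenioid.IsGroupLikeObj F₂ (Ψ.functor.obj A) := by
  rw [isGroupLikeObj_iff_preSteps_isIso hF₂ hi₂]
  intro B' φ' hφ'
  have hρ : PreFrobenioid.IsPreStep F₁ (Ψ.inverse.map φ') := hΨ' hφ'
  have h1 : PreFrobenioid.IsPreStep F₁ (Ψ.unit.app A ≫ Ψ.inverse.map φ') :=
    PreFrobenioid.IsPreStep.comp F₁ (PreFrobenioid.isPreStep_of_isIso F₁ _) hρ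
  haveI : IsIso (Ψ.unit.app A ≫ Ψ.inverse.map φ') :=
    (isGroupLikeObj_iff_preSteps_isIso hF₁ hi₁ A).1 hA _ h1
  haveI : IsIso (Ψ.inverse.map φ') := IsIso.of_isIso_comp_left (Ψ.unit.app A) (Ψ.inverse.map φ')
  exact isIso_of_fully_faithful Ψ.inverse φ'

/-- If `Ψ` preserves pre-steps it maps steps to steps (isomorphisms are reflected).
[cite: MochizukiFrdI2008, Thm. 3.4 (ii) p.62] -/
theorem isStep_map (Ψ : C₁ ≌ C₂)
    (hΨ : ∀ ⦃A B : C₁⦄ ⦃φ : A ⟶ B⦄, PreFrobenioid.IsPreStep F₁ φ →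
      PreFrobenioid.IsPreStep F₂ (Ψ.functor.map φ))
    {A B : C₁} {α : A ⟶ B} (hα : PreFrobenioid.IsStep F₁ α) :
    PreFrobenioid.IsStep F₂ (Ψ.functor.map α) :=
  ⟨hΨ hα.1, fun _ => hα.2 (isIso_of_fully_faithful Ψ.functor α)⟩

/-- If `Ψ⁻¹` preserves pre-steps, a pre-step `Ψ(φ)` comes from a pre-step `φ` (conjugate by the
unit). [cite: MochizukiFrdI2008, Thm. 3.4 (ii) p.62] -/
theorem isPreStep_of_map (Ψ : C₁ ≌ C₂)
    (hΨ' : ∀ ⦃A B : C₂⦄ ⦃φ : A ⟶ B⦄, PreFrobenioid.IsPreStep F₂ φ →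
      PreFrobenioid.IsPreStep F₁ (Ψ.inverse.map φ))
    {A B : C₁} {φ : A ⟶ B} (h : PreFrobenioid.IsPreStep F₂ (Ψ.functor.map φ)) :
    PreFrobenioid.IsPreStep F₁ φ := by
  have h1 := hΨ' h
  rw [Ψ.inv_fun_map] at h1
  have e : φ = Ψ.unit.app A ≫ (Ψ.unitInv.app A ≫ φ ≫ Ψ.unit.app B) ≫ Ψ.unitInv.app B := by simp
  rw [e]
  exact PreFrobenioid.IsPreStep.comp F₁ (PreFrobenioid.isPreStep_of_isIso F₁ _)
    (PreFrobenioid.IsPreStep.comp F₁ h1 (PreFrobenioid.isPreStep_of_isIso F₁ _))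

/-! ### (F1): `Div`-identity prime-Frobenius endomorphisms -/

/-- **Thm. 3.4 (iii), (F1) core: `Ψ` preserves `Div`-identity prime-Frobenius endomorphisms of
non-group-like objects** (Frobenioids of isotropic type, `Φ₂` non-dilating, `Ψ`, `Ψ⁻¹` preserving
pre-steps; via Prop. 1.14 (v)). [cite: MochizukiFrdI2008, Thm. 3.4 (iii) p.65] -/
theorem isDivIdentity_isPrimeFrobenius_map (hF₁ : PreFrobenioid.IsFrobenioid F₁)
    (hF₂ : PreFrobenioid.IsFrobenioid F₂) (hi₁ : ∀ A : C₁, PreFrobenioid.IsIsotropic F₁ A)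
    (hi₂ : ∀ A : C₂, PreFrobenioid.IsIsotropic F₂ A) (hnd₂ : IsNonDilatingOn Φ₂) (Ψ : C₁ ≌ C₂)
    (hΨ : ∀ ⦃A B : C₁⦄ ⦃φ : A ⟶ B⦄, PreFrobenioid.IsPreStep F₁ φ →
      PreFrobenioid.IsPreStep F₂ (Ψ.functor.map φ))
    (hΨ' : ∀ ⦃A B : C₂⦄ ⦃φ : A ⟶ B⦄, PreFrobenioid.IsPreStep F₂ φ →
      PreFrobenioid.IsPreStep F₁ (Ψ.inverse.map φ))
    {A : C₁} (hA : ¬ PreFrobenioid.IsGroupLikeObj F₁ A)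
    {φ : A ⟶ A} (hdi : PreFrobenioid.IsDivIdentity F₁ φ) (hpf : PreFrobenioid.IsPrimeFrobenius F₁ φ) :
    PreFrobenioid.IsDivIdentity F₂ (Ψ.functor.map φ) ∧
      PreFrobenioid.IsPrimeFrobenius F₂ (Ψ.functor.map φ) := by
  have hP₁ := hF₁.isPreFrobenioid
  refine PreFrobenioid.isDivIdentity_isPrimeFrobenius_of_squares F₂ hF₂ hi₂ hnd₂ ?_ ?_ ?_ ?_
  · -- `Ψ φ` is not a pre-step (else `φ` would be one, of prime degree)
    intro h
    have h1 := isPreStep_of_map Ψ hΨ' h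
    have hd : (PreFrobenioid.degFr F₁ φ : ℕ) = 1 := by
      rw [show PreFrobenioid.degFr F₁ φ = 1 from h1.1, PNat.one_coe]
    exact (Nat.Prime.one_lt hpf.2).ne' hd
  · exact (hpf.isIrreducibleHom hF₁ (hi₁ A)).map_equivalence Ψ
  · -- `Ψ A` is not group-like
    intro hGA
    have h1 := isGroupLikeObj_map hF₂ hF₁ hi₂ hi₁ Ψ.symm hΨ hGA
    exact hA (isGroupLikeObj_of_iso hP₁ (Ψ.unitIso.app A).symm h1)
  · -- the squares of Prop. 1.14 (v), transported along `Ψ`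
    intro B₂ α₂ hα₂
    -- pull the step back to `C₁`
    let α₁ : A ⟶ Ψ.inverse.obj B₂ := Ψ.unit.app A ≫ Ψ.inverse.map α₂
    have hα₁p : PreFrobenioid.IsPreStep F₁ α₁ :=
      PreFrobenioid.IsPreStep.comp F₁ (PreFrobenioid.isPreStep_of_isIso F₁ _) (hΨ' hα₂.1)
    have hα₁ : PreFrobenioid.IsStep F₁ α₁ := by
      refine ⟨hα₁p, fun h => hα₂.2 ?_⟩
      haveI : IsIso (Ψ.unit.app A ≫ Ψ.inverse.map α₂) := h
      haveI : IsIso (Ψ.inverse.map α₂) := IsIso.of_isIso_comp_left (Ψ.unit.app A) (Ψ.inverse.map α₂)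
      exact isIso_of_fully_faithful Ψ.inverse α₂
    obtain ⟨B', ψ₁, β₁, ⟨hψirr, hψnps⟩, hβ₁, hsq⟩ :=
      PreFrobenioid.exists_square_of_isDivIdentity_isPrimeFrobenius F₁ hF₁ hi₁ hdi hpf α₁ hα₁
    -- hsq : α₁ ≫ ψ₁ = φ ≫ α₁ ≫ β₁ ; push forward: `Ψ α₁ = α₂ ≫ ε⁻¹`
    have hmap : Ψ.functor.map α₁ = α₂ ≫ Ψ.counitInv.app B₂ := by
      simp only [α₁, Functor.map_comp, Equivalence.fun_inv_map, Equivalence.functor_unit_comp_assoc]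
    have hsq₂ := congrArg Ψ.functor.map hsq
    simp only [Functor.map_comp, hmap, Category.assoc] at hsq₂
    refine ⟨Ψ.functor.obj B', Ψ.counitInv.app B₂ ≫ Ψ.functor.map ψ₁,
      Ψ.counitInv.app B₂ ≫ Ψ.functor.map β₁, ⟨?_, ?_⟩, ⟨?_, ?_⟩, hsq₂⟩
    · exact (hψirr.map_equivalence Ψ).of_arrow_iso (Ψ.counitIso.app B₂) (Iso.refl _) (by simp)
    · intro h
      apply hψnps
      apply isPreStep_of_map Ψ hΨ'
      have e : Ψ.functor.map ψ₁ = Ψ.counit.app B₂ ≫ (Ψ.counitInv.app B₂ ≫ Ψ.functor.map ψ₁) := by simp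
      rw [e]
      exact PreFrobenioid.IsPreStep.comp F₂ (PreFrobenioid.isPreStep_of_isIso F₂ _) h
    · exact PreFrobenioid.IsPreStep.comp F₂ (PreFrobenioid.isPreStep_of_isIso F₂ _)
        (isStep_map Ψ hΨ hβ₁).1
    · intro h
      haveI : IsIso (Ψ.counitInv.app B₂ ≫ Ψ.functor.map β₁) := h
      exact (isStep_map Ψ hΨ hβ₁).2
        (IsIso.of_isIso_comp_left (Ψ.counitInv.app B₂) (Ψ.functor.map β₁))

/-! ### (F2): admissibility propagates along pre-steps -/

/-- **(F2), pre-step case.** Along a pre-step `ζ : A → B`, the images of the `p₁`-Frobenius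
morphisms out of `A` and out of `B` are simultaneously prime-Frobenius, of the same degree (Frobenius
conjugation, Prop. 1.10 (i); Prop. 1.14 (iv) applied to the image square, whose pre-step sides stay
pre-steps by hypothesis). [cite: MochizukiFrdI2008, Thm. 3.4 (iii) p.65] -/
theorem isPrimeFrobenius_map_iff_of_isPreStep (hF₁ : PreFrobenioid.IsFrobenioid F₁)
    (hF₂ : PreFrobenioid.IsFrobenioid F₂) (hi₁ : ∀ A : C₁, PreFrobenioid.IsIsotropic F₁ A)
    (hi₂ : ∀ A : C₂, PreFrobenioid.IsIsotropic F₂ A) (Ψ : C₁ ≌ C₂)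
    (hΨ : ∀ ⦃A B : C₁⦄ ⦃φ : A ⟶ B⦄, PreFrobenioid.IsPreStep F₁ φ →
      PreFrobenioid.IsPreStep F₂ (Ψ.functor.map φ))
    {A B A' B' : C₁} {ζ : A ⟶ B} (hζ : PreFrobenioid.IsPreStep F₁ ζ) {fA : A ⟶ A'} {fB : B ⟶ B'}
    (hfA : PreFrobenioid.IsFrobeniusType F₁ fA) (hfB : PreFrobenioid.IsFrobeniusType F₁ fB)
    (hd : PreFrobenioid.degFr F₁ fA = PreFrobenioid.degFr F₁ fB)
    (hp : (PreFrobenioid.degFr F₁ fA : ℕ).Prime) :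
    (PreFrobenioid.IsPrimeFrobenius F₂ (Ψ.functor.map fA) ↔
        PreFrobenioid.IsPrimeFrobenius F₂ (Ψ.functor.map fB)) ∧
      PreFrobenioid.degFr F₂ (Ψ.functor.map fA) = PreFrobenioid.degFr F₂ (Ψ.functor.map fB) := by
  obtain ⟨ζ', hsq, -⟩ := PreFrobenioid.existsUnique_frobeniusConjugate hF₁ ζ hfA hfB hd
  -- hsq : fA ≫ ζ' = ζ ≫ fB
  have hζ' : PreFrobenioid.IsPreStep F₁ ζ' := hζ.frobeniusConjugate hF₁ hsq hfA hfB hd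
  have hsq₂ : Ψ.functor.map ζ ≫ Ψ.functor.map fB = Ψ.functor.map fA ≫ Ψ.functor.map ζ' := by
    rw [← Functor.map_comp, ← Functor.map_comp, hsq]
  have h1 : PreFrobenioid.degFr F₂ (Ψ.functor.map ζ) = PreFrobenioid.degFr F₂ (Ψ.functor.map ζ') := by
    rw [show PreFrobenioid.degFr F₂ (Ψ.functor.map ζ) = 1 from (hΨ hζ).1,
      show PreFrobenioid.degFr F₂ (Ψ.functor.map ζ') = 1 from (hΨ hζ').1]
  have hpA : PreFrobenioid.IsPrimeFrobenius F₁ fA := ⟨hfA, hp⟩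
  have hpB : PreFrobenioid.IsPrimeFrobenius F₁ fB := ⟨hfB, by rw [← hd]; exact hp⟩
  obtain ⟨hiff, hdeg⟩ := PreFrobenioid.isPrimeFrobenius_iff_of_square F₂ hF₂ hi₂ hsq₂ h1
    ((hpB.isIrreducibleHom hF₁ (hi₁ _)).map_equivalence Ψ)
    ((hpA.isIrreducibleHom hF₁ (hi₁ _)).map_equivalence Ψ)
  exact ⟨hiff.symm, hdeg.symm⟩

/-! ### Prime-Frobenius morphisms out of non-group-like objects are preserved -/

/-- **Thm. 3.4 (iii), (F1)+(F2): `Ψ` maps prime-Frobenius morphisms out of NON-GROUP-LIKE objects to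
prime-Frobenius morphisms** (isotropic type, `Φ₂` non-dilating, `Ψ`, `Ψ⁻¹` preserving pre-steps): a
base-isomorphic Frobenius-trivial object `T` (Def. 1.3 (i)(a)) is reached from the domain by a span of
pre-steps (Def. 1.3 (i)(b)); its base-identity `p`-Frobenius endomorphism is mapped to a prime-Frobenius
endomorphism by (F1), and (F2) carries this back along the two pre-steps.
[cite: MochizukiFrdI2008, Thm. 3.4 (iii) p.65] -/
theorem isPrimeFrobenius_map_of_not_isGroupLikeObj (hF₁ : PreFrobenioid.IsFrobenioid F₁)
    (hF₂ : PreFrobenioid.IsFrobenioid F₂) (hi₁ : ∀ A : C₁, PreFrobenioid.IsIsotropic F₁ A)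
    (hi₂ : ∀ A : C₂, PreFrobenioid.IsIsotropic F₂ A) (hnd₂ : IsNonDilatingOn Φ₂) (Ψ : C₁ ≌ C₂)
    (hΨ : ∀ ⦃A B : C₁⦄ ⦃φ : A ⟶ B⦄, PreFrobenioid.IsPreStep F₁ φ →
      PreFrobenioid.IsPreStep F₂ (Ψ.functor.map φ))
    (hΨ' : ∀ ⦃A B : C₂⦄ ⦃φ : A ⟶ B⦄, PreFrobenioid.IsPreStep F₂ φ →
      PreFrobenioid.IsPreStep F₁ (Ψ.inverse.map φ))
    {A A' : C₁} (hA : ¬ PreFrobenioid.IsGroupLikeObj F₁ A)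
    {f : A ⟶ A'} (hf : PreFrobenioid.IsPrimeFrobenius F₁ f) :
    PreFrobenioid.IsPrimeFrobenius F₂ (Ψ.functor.map f) := by
  have hP₁ := hF₁.isPreFrobenioid
  -- a Frobenius-trivial object over the base of `A`, and a span of pre-steps `A ← X → T`
  obtain ⟨T, hT, ⟨e⟩⟩ := hF₁.i_a (PreFrobenioid.baseObj F₁ A)
  obtain ⟨X, φ, ψ, hφ, hψ, -⟩ := hF₁.i_b A T e.symm
  -- the `p`-Frobenius endomorphism of `T` and the `p`-Frobenius morphism out of `X`
  obtain ⟨ζ, hζ⟩ := hT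
  obtain ⟨hζd, hζb, hζF⟩ := hζ (PreFrobenioid.degFr F₁ f)
  obtain ⟨X', fX, hfX, hfXd⟩ := hF₁.ii_exists X (PreFrobenioid.degFr F₁ f)
  -- `T` is not group-like (it is base-isomorphic to `A` through `X`)
  have hT' : ¬ PreFrobenioid.IsGroupLikeObj F₁ T := fun h =>
    hA (isGroupLikeObj_of_isBaseIso hP₁ φ (isGroupLikeObj_of_isBaseIso' hP₁ ψ hψ.2 h))
  -- (F1) at `T`
  have hζdi : PreFrobenioid.IsDivIdentity F₁ (ζ (PreFrobenioid.degFr F₁ f)) := by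
    change pull Φ₁ (PreFrobenioid.Base F₁ _) = MonoidHom.id _
    rw [show PreFrobenioid.Base F₁ (ζ (PreFrobenioid.degFr F₁ f)) = 𝟙 _ from hζb]
    exact MonoidHom.ext fun x => pull_id Φ₁ _ x
  have hζp : PreFrobenioid.IsPrimeFrobenius F₁ (ζ (PreFrobenioid.degFr F₁ f)) :=
    ⟨hζF, by rw [hζd]; exact hf.2⟩
  have h1 := (isDivIdentity_isPrimeFrobenius_map hF₁ hF₂ hi₁ hi₂ hnd₂ Ψ hΨ hΨ' hT' hζdi hζp).2
  -- (F2) along `ψ : X → T`, then along `φ : X → A`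
  have h2 : PreFrobenioid.IsPrimeFrobenius F₂ (Ψ.functor.map fX) :=
    (isPrimeFrobenius_map_iff_of_isPreStep hF₁ hF₂ hi₁ hi₂ Ψ hΨ hψ hfX hζF
      (hfXd.trans hζd.symm) (by rw [hfXd]; exact hf.2)).1.2 h1
  exact (isPrimeFrobenius_map_iff_of_isPreStep hF₁ hF₂ hi₁ hi₂ Ψ hΨ hφ hfX hf.1 hfXd
    (by rw [hfXd]; exact hf.2)).1.1 h2

/-! ### Transport of admissibility through the base category (Def. 1.3 (i)(a)–(c)) -/

/-- Transport of admissibility between objects with isomorphic bases (Def. 1.3 (i)(b): a span of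
pre-steps; (F2), pre-step case). [cite: MochizukiFrdI2008, Thm. 3.4 (iii) p.64] -/
theorem admissible_of_baseIso (hF₁ : PreFrobenioid.IsFrobenioid F₁)
    (hF₂ : PreFrobenioid.IsFrobenioid F₂) (hi₁ : ∀ A : C₁, PreFrobenioid.IsIsotropic F₁ A)
    (hi₂ : ∀ A : C₂, PreFrobenioid.IsIsotropic F₂ A) (Ψ : C₁ ≌ C₂)
    (hΨ : ∀ ⦃A B : C₁⦄ ⦃φ : A ⟶ B⦄, PreFrobenioid.IsPreStep F₁ φ →
      PreFrobenioid.IsPreStep F₂ (Ψ.functor.map φ))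
    {p p' : ℕ+} (hp : (p : ℕ).Prime) {A B : C₁}
    (e : PreFrobenioid.baseObj F₁ A ≅ PreFrobenioid.baseObj F₁ B)
    (hA : (∀ ⦃A₁' : C₁⦄ (f : A ⟶ A₁'), PreFrobenioid.IsFrobeniusType F₁ f → PreFrobenioid.degFr F₁ f = p →
      PreFrobenioid.IsPrimeFrobenius F₂ (Ψ.functor.map f) ∧ PreFrobenioid.degFr F₂ (Ψ.functor.map f) = p')) :
    (∀ ⦃A₂' : C₁⦄ (f : B ⟶ A₂'), PreFrobenioid.IsFrobeniusType F₁ f → PreFrobenioid.degFr F₁ f = p →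
      PreFrobenioid.IsPrimeFrobenius F₂ (Ψ.functor.map f) ∧ PreFrobenioid.degFr F₂ (Ψ.functor.map f) = p') := by
  obtain ⟨X, φ, ψ, hφ, hψ, -⟩ := hF₁.i_b A B e
  obtain ⟨A', f, hf, hfd⟩ := hF₁.ii_exists A p
  obtain ⟨X', fX, hfX, hfXd⟩ := hF₁.ii_exists X p
  obtain ⟨B', g, hg, hgd⟩ := hF₁.ii_exists B p
  have hpX : (PreFrobenioid.degFr F₁ fX : ℕ).Prime := by rw [hfXd]; exact hp
  obtain ⟨hΨf, hΨfd⟩ := hA f hf hfd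
  obtain ⟨hiffA, hdegA⟩ := isPrimeFrobenius_map_iff_of_isPreStep hF₁ hF₂ hi₁ hi₂ Ψ hΨ hφ hfX hf
    (hfXd.trans hfd.symm) hpX
  obtain ⟨hiffB, hdegB⟩ := isPrimeFrobenius_map_iff_of_isPreStep hF₁ hF₂ hi₁ hi₂ Ψ hΨ hψ hfX hg
    (hfXd.trans hgd.symm) hpX
  exact admissible_of_rep hF₁ hF₂ Ψ hg hgd (hiffB.1 (hiffA.2 hΨf)) (hdegB ▸ hdegA ▸ hΨfd)

/-- Transport of admissibility ALONG AN ARROW OF THE BASE `u : P → Q` (both directions): through a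
Frobenius-trivial object over `Q` (Def. 1.3 (i)(a)), a pull-back morphism over `u` into it (Def. 1.3
(i)(c)) and the lifted Frobenius endomorphism ((F2), pull-back case, Prop. 1.14 (iv)).
[cite: MochizukiFrdI2008, Thm. 3.4 (iii) p.65] -/
theorem admissible_iff_of_base_hom (hF₁ : PreFrobenioid.IsFrobenioid F₁)
    (hF₂ : PreFrobenioid.IsFrobenioid F₂) (hi₁ : ∀ A : C₁, PreFrobenioid.IsIsotropic F₁ A)
    (hi₂ : ∀ A : C₂, PreFrobenioid.IsIsotropic F₂ A) (Ψ : C₁ ≌ C₂)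
    (hΨ : ∀ ⦃A B : C₁⦄ ⦃φ : A ⟶ B⦄, PreFrobenioid.IsPreStep F₁ φ →
      PreFrobenioid.IsPreStep F₂ (Ψ.functor.map φ))
    {p p' : ℕ+} (hp : (p : ℕ).Prime) {P Q : D₁} (u : P ⟶ Q) {A B : C₁}
    (eA : PreFrobenioid.baseObj F₁ A ≅ P) (eB : PreFrobenioid.baseObj F₁ B ≅ Q) :
    (∀ ⦃A₁' : C₁⦄ (f : A ⟶ A₁'), PreFrobenioid.IsFrobeniusType F₁ f → PreFrobenioid.degFr F₁ f = p →
      PreFrobenioid.IsPrimeFrobenius F₂ (Ψ.functor.map f) ∧ PreFrobenioid.degFr F₂ (Ψ.functor.map f) = p') ↔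
    (∀ ⦃A₂' : C₁⦄ (f : B ⟶ A₂'), PreFrobenioid.IsFrobeniusType F₁ f → PreFrobenioid.degFr F₁ f = p →
      PreFrobenioid.IsPrimeFrobenius F₂ (Ψ.functor.map f) ∧ PreFrobenioid.degFr F₂ (Ψ.functor.map f) = p') := by
  -- a Frobenius-trivial `T` over `Q`, a pull-back `ζ : W → T` over `u`, with `W` over `P`
  obtain ⟨T, hT, ⟨eT⟩⟩ := hF₁.i_a Q
  obtain ⟨W, ζ, i, hζ, -⟩ := exists_isPullbackMorphism_over' hF₁ T (u ≫ eT.inv)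
  obtain ⟨z, hz⟩ := hT
  obtain ⟨hzd, hzb, hzF⟩ := hz p
  obtain ⟨φ, hφF, -, hφd, hsq⟩ := exists_frobenius_endo_lift hF₁ hi₁ hζ hzF hzb
  have hzp : PreFrobenioid.IsPrimeFrobenius F₁ (z p) := ⟨hzF, by rw [hzd]; exact hp⟩
  have hφp : PreFrobenioid.IsPrimeFrobenius F₁ φ := ⟨hφF, by rw [hφd, hzd]; exact hp⟩
  obtain ⟨hiff, hdeg⟩ := isPrimeFrobenius_map_iff_of_isPullbackMorphism hF₁ hF₂ hi₁ hi₂ Ψ hφp hzp hsq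
  constructor
  · intro hA
    obtain ⟨h1, h2⟩ := admissible_of_baseIso hF₁ hF₂ hi₁ hi₂ Ψ hΨ hp (eA.trans i.symm) hA φ hφF
      (hφd.trans hzd)
    exact admissible_of_baseIso hF₁ hF₂ hi₁ hi₂ Ψ hΨ hp (eT.trans eB.symm)
      (admissible_of_rep hF₁ hF₂ Ψ hzF hzd (hiff.1 h1) (hdeg ▸ h2))
  · intro hB
    obtain ⟨h1, h2⟩ := admissible_of_baseIso hF₁ hF₂ hi₁ hi₂ Ψ hΨ hp (eB.trans eT.symm) hB (z p) hzF hzd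
    exact admissible_of_baseIso hF₁ hF₂ hi₁ hi₂ Ψ hΨ hp (i.trans eA.symm)
      (admissible_of_rep hF₁ hF₂ Ψ hφF (hφd.trans hzd) (hiff.2 h1) (hdeg.symm ▸ h2))

/-- **Thm. 3.4 (iii): `Ψ` maps `p`-Frobenius morphisms to `p'`-Frobenius morphisms for a single prime
`p'` depending only on `p`**, for Frobenioids of isotropic type with `Φ₂` non-dilating and `Ψ`, `Ψ⁻¹`
preserving pre-steps, provided `C₁` has a non-group-like object: (F1) at a base-isomorphic
Frobenius-trivial object, (F2) along pre-steps and pull-backs, connectedness of the base.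
[cite: MochizukiFrdI2008, Thm. 3.4 (iii) p.65] -/
theorem exists_admissible_all (hF₁ : PreFrobenioid.IsFrobenioid F₁)
    (hF₂ : PreFrobenioid.IsFrobenioid F₂) (hi₁ : ∀ A : C₁, PreFrobenioid.IsIsotropic F₁ A)
    (hi₂ : ∀ A : C₂, PreFrobenioid.IsIsotropic F₂ A) (hnd₂ : IsNonDilatingOn Φ₂) (Ψ : C₁ ≌ C₂)
    (hΨ : ∀ ⦃A B : C₁⦄ ⦃φ : A ⟶ B⦄, PreFrobenioid.IsPreStep F₁ φ →
      PreFrobenioid.IsPreStep F₂ (Ψ.functor.map φ))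
    (hΨ' : ∀ ⦃A B : C₂⦄ ⦃φ : A ⟶ B⦄, PreFrobenioid.IsPreStep F₂ φ →
      PreFrobenioid.IsPreStep F₁ (Ψ.inverse.map φ))
    {N : C₁} (hN : ¬ PreFrobenioid.IsGroupLikeObj F₁ N) (p : ℕ+) (hp : (p : ℕ).Prime) :
    ∃ p' : ℕ+, (p' : ℕ).Prime ∧ ∀ A : C₁, (∀ ⦃A₃' : C₁⦄ (f : A ⟶ A₃'), PreFrobenioid.IsFrobeniusType F₁ f →
      PreFrobenioid.degFr F₁ f = p →
      PreFrobenioid.IsPrimeFrobenius F₂ (Ψ.functor.map f) ∧ PreFrobenioid.degFr F₂ (Ψ.functor.map f) = p') := by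
  have hP₁ := hF₁.isPreFrobenioid
  -- the value `p'`: the degree of the image of the `p`-Frobenius out of `N`
  obtain ⟨N', f₀, hf₀, hf₀d⟩ := hF₁.ii_exists N p
  have hf₀p : PreFrobenioid.IsPrimeFrobenius F₁ f₀ := ⟨hf₀, by rw [hf₀d]; exact hp⟩
  have hΨf₀ := isPrimeFrobenius_map_of_not_isGroupLikeObj hF₁ hF₂ hi₁ hi₂ hnd₂ Ψ hΨ hΨ' hN hf₀p
  refine ⟨PreFrobenioid.degFr F₂ (Ψ.functor.map f₀), hΨf₀.2, ?_⟩
  -- admissibility of all objects over a given base object is constant along the (connected) base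
  let S : D₁ → Prop := fun P => ∀ ⦃B : C₁⦄, Nonempty (PreFrobenioid.baseObj F₁ B ≅ P) →
    (∀ ⦃A₄' : C₁⦄ (f : B ⟶ A₄'), PreFrobenioid.IsFrobeniusType F₁ f → PreFrobenioid.degFr F₁ f = p →
      PreFrobenioid.IsPrimeFrobenius F₂ (Ψ.functor.map f) ∧
        PreFrobenioid.degFr F₂ (Ψ.functor.map f) = PreFrobenioid.degFr F₂ (Ψ.functor.map f₀))
  have hstep : ∀ {P Q : D₁}, Nonempty (P ⟶ Q) ∨ Nonempty (Q ⟶ P) → (S P ↔ S Q) := by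
    have one : ∀ {P Q : D₁} (u : P ⟶ Q), S P → S Q := by
      intro P Q u hP B ⟨eB⟩
      obtain ⟨TA, -, ⟨eA⟩⟩ := hF₁.i_a P
      exact (admissible_iff_of_base_hom hF₁ hF₂ hi₁ hi₂ Ψ hΨ hp u eA eB).1 (hP ⟨eA⟩)
    have two : ∀ {P Q : D₁} (u : P ⟶ Q), S Q → S P := by
      intro P Q u hQ A ⟨eA⟩
      obtain ⟨TB, -, ⟨eB⟩⟩ := hF₁.i_a Q
      exact (admissible_iff_of_base_hom hF₁ hF₂ hi₁ hi₂ Ψ hΨ hp u eA eB).2 (hQ ⟨eB⟩)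
    intro P Q h
    rcases h with ⟨⟨u⟩⟩ | ⟨⟨u⟩⟩
    · exact ⟨one u, two u⟩
    · exact ⟨two u, one u⟩
  have hconst : ∀ P Q : D₁, S P ↔ S Q := by
    intro P Q
    induction hP₁.isGraphConnected_base.zigzag P Q with
    | refl => exact Iff.rfl
    | tail _ hbc ih => exact ih.trans (hstep hbc)
  have hSN : S (PreFrobenioid.baseObj F₁ N) := fun B ⟨eB⟩ =>
    admissible_of_baseIso hF₁ hF₂ hi₁ hi₂ Ψ hΨ hp eB.symm (admissible_of_rep hF₁ hF₂ Ψ hf₀ hf₀d hΨf₀ rfl)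
  exact fun A => (hconst _ _).1 hSN ⟨Iso.refl _⟩

/-- **Thm. 3.4 (iii): `Ψ` maps prime-Frobenius morphisms to prime-Frobenius morphisms** (isotropic
type, `Φ₂` non-dilating, `Ψ`, `Ψ⁻¹` preserving pre-steps, `C₁` with a non-group-like object).
[cite: MochizukiFrdI2008, Thm. 3.4 (iii) p.65] -/
theorem isPrimeFrobenius_map (hF₁ : PreFrobenioid.IsFrobenioid F₁)
    (hF₂ : PreFrobenioid.IsFrobenioid F₂) (hi₁ : ∀ A : C₁, PreFrobenioid.IsIsotropic F₁ A)
    (hi₂ : ∀ A : C₂, PreFrobenioid.IsIsotropic F₂ A) (hnd₂ : IsNonDilatingOn Φ₂) (Ψ : C₁ ≌ C₂)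
    (hΨ : ∀ ⦃A B : C₁⦄ ⦃φ : A ⟶ B⦄, PreFrobenioid.IsPreStep F₁ φ →
      PreFrobenioid.IsPreStep F₂ (Ψ.functor.map φ))
    (hΨ' : ∀ ⦃A B : C₂⦄ ⦃φ : A ⟶ B⦄, PreFrobenioid.IsPreStep F₂ φ →
      PreFrobenioid.IsPreStep F₁ (Ψ.inverse.map φ))
    {N : C₁} (hN : ¬ PreFrobenioid.IsGroupLikeObj F₁ N)
    {A A' : C₁} {f : A ⟶ A'} (hf : PreFrobenioid.IsPrimeFrobenius F₁ f) :
    PreFrobenioid.IsPrimeFrobenius F₂ (Ψ.functor.map f) := by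
  obtain ⟨p', -, hall⟩ := exists_admissible_all hF₁ hF₂ hi₁ hi₂ hnd₂ Ψ hΨ hΨ' hN
    (PreFrobenioid.degFr F₁ f) hf.2
  exact (hall A f hf.1 rfl).1

end Two

end OfPreSteps

end FrdI

end Literature.AlgebraicGeometry.Frobenioids
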